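import Literature.IUT.HodgeTheaters.StableCurveTemperedDataOfSpecialFibreSec2A3Trichotomy
import Literature.AnabelianGeometry.SemiGraphs.NodNonArithCosetTreeTrichotomy
import HarnessLib

/-!
# The §2 one-call with its LAST LAW NAMED: `hA3tri_j` := abc-iut-L3's [NodNon] Prop 3.9 (i) predicate
# `DecompositionData.ArithCosetTreeTrichotomy` BY NAME, and `hVc_j` := [SemiAnbd] Rmk 5.3.1 BY NAME
# ([IUTchI] Prop. 2.4 (i)(ii)(iii) ∧ Cor. 2.5 at the genuine 𝔛-datum; row R74 «COR25-HA3AR-ONE-CALL»)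

S. Mochizuki, *Inter-universal Teichmüller theory I*, kurims manuscript (May 2020), §2, proof of Prop. 2.4 (ii), p. 50
l. 52 – p. 51 l. 13 [cite: Mochizuki2012, Prop 2.4(ii) pp.50-51]: «instead of applying [SemiAnbd], Theorem 3.7, (iii), we
apply its arithmetic analogue, namely, [SemiAnbd], Theorem 5.4, (ii); [SemiAnbd], Example 5.6 … Here, we note that when
one applies either [AbsTopII], Proposition 1.3, (iv), or [NodNon], Proposition 3.9, (i) … to the vertices “`v″`”,
“`(v′)^γ`”, one may only conclude that these two vertices either coincide, are adjacent, or admit a common adjacent vertex;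
but this is still sufficient to conclude the temperedness of “`(v′)^γ`” from that of “`v″`”.» (D-0012 claim key; series
status DISPUTED — nothing of the series is asserted here); Y. Hoshi–S. Mochizuki [NodNon] Prop. 3.9 (i) (kurims ms p. 48)
[cite: HoshiMochizukiNodNon2011, Prop 3.9 (i) p.48]; S. Mochizuki [SemiAnbd] Rmk 5.3.1 p. 65, Thm 5.4 (i) p. 66
[cite: MochizukiSemiAnbd2006, Rmk 5.3.1, p. 65].

PROOF-ONLY file (abc-iut cell, L5 [IUTchI] §2 lineage; seat abc-iut-L5-t9 gen 8, row R74 «COR25-HA3AR-ONE-CALL» of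
abc-iut-L5-lead RULINGS #139 with abc-iut-L3-lead INTERFACE RULING Q6′ 2026-08-27T08:39:31Z; no definition, no instance,
no notation, no new `Prop` fact).  STATE OF RECORD: abc-iut-L5-t11 gen 15's ★ p506978
`StableCurveTemperedDataOfSpecialFibreSec2A3Trichotomy` carries the §2 one-call in PRINT-FAITHFUL form with the binders
`hVc_j` ([SemiAnbd] Rmk 5.3.1 compactness, a raw section hypothesis) and `hA3tri_j` (the [AbsTopII] Prop 1.3 (iv)-refined /
[NodNon] Prop 3.9 (i) coset-trichotomy, typed BY SHAPE only).  THIS FILE names both BY abc-iut-L3's typed predicates so that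
the two one-calls read every law BY NAME, restating NOTHING:

* `hVc_of_verticialEdgeLikeCompactAmpleStatement` — `hVc_j` ⟸ `VerticialEdgeLikeCompactAmpleStatement (Dd j) πA_j`
  ([SemiAnbd] Rmk 5.3.1 at the canonical Prop 5.2 (iv) frame, the SAME augmentation as `hI_j^frame`) by ★ p506978 § A;
* `hA3tri_of_arithCosetTreeTrichotomy` — `hA3tri_j` IS `(Dd j).ArithCosetTreeTrichotomy ι_j (q̂_j ∘ toHat) (Π^temp_{X_K} ↠ G_K)`
  (abc-iut-L3's `Literature.AnabelianGeometry.SemiGraphs.DecompositionData.ArithCosetTreeTrichotomy`, the arithmetic twin of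
  F-2540) — DEFINITIONALLY (`fun j => hA3 j`);
* NO re-keyed one-call is declared: with the two bridges, ★ p506978's `…_of_isFreeOrSurface_trichotomy` / `…_of_freePro_trichotomy`
  ARE the by-name one-calls (the gate's `dedup.landed` check identifies a verbatim re-key with them definitionally); the exact call is
  written out in the doc-block at the end of this file.

BINDER CENSUS after this file (abc-iut-L5-lead RULINGS #110 (4) grammar), [IUTchI] Cor 2.5 at the genuine 𝔛-datum:
DATA {X, d, S, Σ/Σ̂ + side conditions, TpH/HatH/hle, cuspMeetsH, T, P : PiData, a cusp x, per-level PSC data G_i/σ/Λv/node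
data, Dd j, arithmetic endpoint data of Dd j (β₁A β₂A srcA tgtA c₁A c₂A with hβe hβne hsrcA htgtA hΓA hloopA hcovA)} ·
FACT BY NAME {hNN_i = F-2540 `PSCDatum.VerticialIntersectionNear` · hI_j^frame = `ArithMaximalCompactStatementI (Dd j) πA_j`
([SemiAnbd] Thm 5.4 (i)) · hVcS_j = `VerticialEdgeLikeCompactAmpleStatement (Dd j) πA_j` ([SemiAnbd] Rmk 5.3.1) · hA3_j =
`(Dd j).ArithCosetTreeTrichotomy …` ([NodNon] Prop 3.9 (i) / [AbsTopII] Prop 1.3 (iv)-refined)} · FACT-INSTANCE (x′) `hF`/`e`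
(resp. (x) `hι`) · ORIGIN hab (G-L5t11g7-1) · GAP hadm (G-w4d058-g10-1) · explicit LAW: NONE.  HONEST TAGS: naming a law is
not discharging it — nothing of [NodNon] Prop 3.9 (i), [AbsTopII] Prop 1.3 (iv), [SemiAnbd] Rmk 5.3.1 / Thm 5.4 (i) is proved;
all four stay displayed CONDITIONAL-BY-NAME hypotheses; typed ≠ inhabited ≠ discharged; nothing here asserts that abc is
proved or refuted, and nothing here bears on [IUTchIII] Cor. 3.12.
-/

noncomputable section

namespace Literature.IUT.HodgeTheaters

open _root_.Topology
open scoped Pointwise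
open Literature.AnabelianGeometry.SemiGraphs Literature.AnabelianGeometry.SemiGraphs.ProfiniteSemiGraph
open Literature.AnabelianGeometry.SemiGraphs.SemiGraphOfAnabelioids (IsProSigmaCompletion)

universe uE

namespace StableCurveTemperedData

namespace OfSpecialFibre

variable {p : ℕ} [Fact p.Prime] (X : TemperedCurve p)

section OneCall

variable (d : X.GroupLevelData) (T : SpecialFibreTower X.DeltaTemp)
  (Sigma SigmaHat : Set ℕ) (hsub : Sigma ⊆ SigmaHat) (hne : Set.Nonempty Sigma)
  (hprime : ∀ q ∈ SigmaHat, q.Prime)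
  (S : SpecialFibreData (X.toTemperedArithmeticGroup d)) (h36 : S.Gc.Prop36Hypotheses)
  (hp : p ∉ Sigma) (TpH : Subgroup S.chart.G)
  (HatH : Subgroup (TemperedGraphGroupData.exists_completion_of_prop36 S.Gc h36 S.chart).choose)
  (hle : TpH.map (TemperedGraphGroupData.exists_completion_of_prop36 S.Gc h36
    S.chart).choose_spec.choose.toMonoidHom ≤ HatH)
  (cuspMeetsH : {x : X.Pt // X.IsCusp x} → Prop)

variable (P : SpecialFibreTower.PiData X d S T) {V B : ℕ → Type*}
  (Dd : ∀ j, DecompositionData ((qTowerOfSpecialFibreTower X T d S h36 Sigma SigmaHat hsub hne hprime hp TpH HatH hle cuspMeetsH P.admKer_normal_pi).Q j).Tp (V j) (B j))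

/-- **`hVc_j` BY NAME** ([SemiAnbd] Rmk 5.3.1 «all verticial and edge-like subgroups of `Π^temp_𝔊` are compact and
arithmetically ample»): abc-iut-L3's typed predicate `VerticialEdgeLikeCompactAmpleStatement (Dd j) πA_j` at the canonical
Prop 5.2 (iv) frame of level `j` yields the compactness of every level-`j` verticial decomposition group — the raw binder
`hVc` of ★ p506978 — by its § A `ArithTrichotomyTransfer.isCompact_vertGp_of_verticialEdgeLikeCompactAmple`.
[cite: MochizukiSemiAnbd2006, Rmk 5.3.1, p. 65] -/
theorem hVc_of_verticialEdgeLikeCompactAmpleStatement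
    (hVcS : ∀ j, haveI := qTower_map_N_normal X d T Sigma SigmaHat hsub hne hprime S h36 hp TpH HatH hle cuspMeetsH P j;
      VerticialEdgeLikeCompactAmpleStatement (Dd j) (QuotientGroup.mk' (((T.N j).map X.DeltaTemp.subtype).map ((qTowerOfSpecialFibreTower X T d S h36 Sigma SigmaHat hsub hne hprime hp TpH HatH hle cuspMeetsH P.admKer_normal_pi).qtp j)))) :
    ∀ (j : ℕ) (v : V j), IsCompact (((Dd j).vertGp v : Subgroup ((qTowerOfSpecialFibreTower X T d S h36 Sigma SigmaHat hsub hne hprime hp TpH HatH hle cuspMeetsH P.admKer_normal_pi).Q j).Tp) : Set ((qTowerOfSpecialFibreTower X T d S h36 Sigma SigmaHat hsub hne hprime hp TpH HatH hle cuspMeetsH P.admKer_normal_pi).Q j).Tp) := by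
  intro j v
  haveI := qTower_map_N_normal X d T Sigma SigmaHat hsub hne hprime S h36 hp TpH HatH hle cuspMeetsH P j
  exact ArithTrichotomyTransfer.isCompact_vertGp_of_verticialEdgeLikeCompactAmple (Dd j) _ (hVcS j) v

/-- **`hA3tri_j` BY NAME — definitionally**: abc-iut-L3's [NodNon] Prop 3.9 (i) predicate
`DecompositionData.ArithCosetTreeTrichotomy` (arithmetic coset-tree trichotomy «coincide / adjacent / common adjacent
vertex», stabilisers = closures; the twin of F-2540) at `(Π^tp_j, Π̂_j, ι_j, Π^temp_{X_K}, q̂_j ∘ toHat, G_K, Π^temp_{X_K} ↠ G_K)`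
IS the print-faithful section hypothesis `hA3tri_j` of ★ p506978, binder for binder.
[cite: HoshiMochizukiNodNon2011, Prop 3.9 (i) p.48] [cite: Mochizuki2012, Prop 2.4(ii) pp.50-51] -/
theorem hA3tri_of_arithCosetTreeTrichotomy
    (hA3 : ∀ j, DecompositionData.ArithCosetTreeTrichotomy.{uE} (Dd j) ((qTowerOfSpecialFibreTower X T d S h36 Sigma SigmaHat hsub hne hprime hp TpH HatH hle cuspMeetsH P.admKer_normal_pi).Q j).ι
      (((qTowerOfSpecialFibreTower X T d S h36 Sigma SigmaHat hsub hne hprime hp TpH HatH hle cuspMeetsH P.admKer_normal_pi).qhat j).comp X.toHat.toMonoidHom) X.augGK.toMonoidHom) :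
    ∀ (j : ℕ) (E : Type uE) (β₁ β₂ : E → B j) (src tgt : E → V j) (c₁ c₂ : E → ((qTowerOfSpecialFibreTower X T d S h36 Sigma SigmaHat hsub hne hprime hp TpH HatH hle cuspMeetsH P.admKer_normal_pi).Q j).Tp),
    (∀ e, (Dd j).edgeOf (β₁ e) = (Dd j).edgeOf (β₂ e)) → (∀ e, β₁ e ≠ β₂ e) →
    (∀ e, (Dd j).abut (β₁ e) = some (src e)) → (∀ e, (Dd j).abut (β₂ e) = some (tgt e)) →
    (∀ e, MulAut.conj (c₁ e) • (Dd j).brGp (β₁ e) = MulAut.conj (c₂ e) • (Dd j).brGp (β₂ e)) →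
    (∀ e, src e = tgt e → (c₁ e)⁻¹ * c₂ e ∉ (Dd j).vertGp (src e)) →
    (∀ (b b' : B j) (v w : V j), (Dd j).edgeOf b = (Dd j).edgeOf b' → b ≠ b' →
      (Dd j).abut b = some v → (Dd j).abut b' = some w → ∃ e, (β₁ e = b ∧ β₂ e = b') ∨ (β₁ e = b' ∧ β₂ e = b)) →
    ∀ (Λ : Subgroup X.PiTemp), IsCompact (Λ : Set X.PiTemp) → Λ ≠ ⊥ →
    IsOpen (Λ.map X.augGK.toMonoidHom : Set X.GK) →
    ∀ (v w : V j) (g h γ : ((qTowerOfSpecialFibreTower X T d S h36 Sigma SigmaHat hsub hne hprime hp TpH HatH hle cuspMeetsH P.admKer_normal_pi).Q j).Hat),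
      MulAut.conj γ • Λ.map (((qTowerOfSpecialFibreTower X T d S h36 Sigma SigmaHat hsub hne hprime hp TpH HatH hle cuspMeetsH P.admKer_normal_pi).qhat j).comp X.toHat.toMonoidHom) ≤
          MulAut.conj g • (((Dd j).vertGp v).map ((qTowerOfSpecialFibreTower X T d S h36 Sigma SigmaHat hsub hne hprime hp TpH HatH hle cuspMeetsH P.admKer_normal_pi).Q j).ι).topologicalClosure →
      MulAut.conj γ • Λ.map (((qTowerOfSpecialFibreTower X T d S h36 Sigma SigmaHat hsub hne hprime hp TpH HatH hle cuspMeetsH P.admKer_normal_pi).qhat j).comp X.toHat.toMonoidHom) ≤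
          MulAut.conj h • (((Dd j).vertGp w).map ((qTowerOfSpecialFibreTower X T d S h36 Sigma SigmaHat hsub hne hprime hp TpH HatH hle cuspMeetsH P.admKer_normal_pi).Q j).ι).topologicalClosure →
        (v = w ∧ g⁻¹ * h ∈ (((Dd j).vertGp v).map ((qTowerOfSpecialFibreTower X T d S h36 Sigma SigmaHat hsub hne hprime hp TpH HatH hle cuspMeetsH P.admKer_normal_pi).Q j).ι).topologicalClosure) ∨
        (∃ (e : E) (k : ((qTowerOfSpecialFibreTower X T d S h36 Sigma SigmaHat hsub hne hprime hp TpH HatH hle cuspMeetsH P.admKer_normal_pi).Q j).Hat), ∃ p ∈ (((Dd j).vertGp (src e)).map ((qTowerOfSpecialFibreTower X T d S h36 Sigma SigmaHat hsub hne hprime hp TpH HatH hle cuspMeetsH P.admKer_normal_pi).Q j).ι).topologicalClosure,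
              ∃ q ∈ (((Dd j).vertGp (tgt e)).map ((qTowerOfSpecialFibreTower X T d S h36 Sigma SigmaHat hsub hne hprime hp TpH HatH hle cuspMeetsH P.admKer_normal_pi).Q j).ι).topologicalClosure,
              (src e = v ∧ tgt e = w ∧ g = k * ((qTowerOfSpecialFibreTower X T d S h36 Sigma SigmaHat hsub hne hprime hp TpH HatH hle cuspMeetsH P.admKer_normal_pi).Q j).ι (c₁ e) * p ∧ h = k * ((qTowerOfSpecialFibreTower X T d S h36 Sigma SigmaHat hsub hne hprime hp TpH HatH hle cuspMeetsH P.admKer_normal_pi).Q j).ι (c₂ e) * q) ∨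
              (src e = w ∧ tgt e = v ∧ h = k * ((qTowerOfSpecialFibreTower X T d S h36 Sigma SigmaHat hsub hne hprime hp TpH HatH hle cuspMeetsH P.admKer_normal_pi).Q j).ι (c₁ e) * p ∧ g = k * ((qTowerOfSpecialFibreTower X T d S h36 Sigma SigmaHat hsub hne hprime hp TpH HatH hle cuspMeetsH P.admKer_normal_pi).Q j).ι (c₂ e) * q)) ∨
        (∃ (u : V j) (f : ((qTowerOfSpecialFibreTower X T d S h36 Sigma SigmaHat hsub hne hprime hp TpH HatH hle cuspMeetsH P.admKer_normal_pi).Q j).Hat),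
          (∃ (e : E) (k : ((qTowerOfSpecialFibreTower X T d S h36 Sigma SigmaHat hsub hne hprime hp TpH HatH hle cuspMeetsH P.admKer_normal_pi).Q j).Hat), ∃ p ∈ (((Dd j).vertGp (src e)).map ((qTowerOfSpecialFibreTower X T d S h36 Sigma SigmaHat hsub hne hprime hp TpH HatH hle cuspMeetsH P.admKer_normal_pi).Q j).ι).topologicalClosure,
              ∃ q ∈ (((Dd j).vertGp (tgt e)).map ((qTowerOfSpecialFibreTower X T d S h36 Sigma SigmaHat hsub hne hprime hp TpH HatH hle cuspMeetsH P.admKer_normal_pi).Q j).ι).topologicalClosure,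
              (src e = v ∧ tgt e = u ∧ g = k * ((qTowerOfSpecialFibreTower X T d S h36 Sigma SigmaHat hsub hne hprime hp TpH HatH hle cuspMeetsH P.admKer_normal_pi).Q j).ι (c₁ e) * p ∧ f = k * ((qTowerOfSpecialFibreTower X T d S h36 Sigma SigmaHat hsub hne hprime hp TpH HatH hle cuspMeetsH P.admKer_normal_pi).Q j).ι (c₂ e) * q) ∨
              (src e = u ∧ tgt e = v ∧ f = k * ((qTowerOfSpecialFibreTower X T d S h36 Sigma SigmaHat hsub hne hprime hp TpH HatH hle cuspMeetsH P.admKer_normal_pi).Q j).ι (c₁ e) * p ∧ g = k * ((qTowerOfSpecialFibreTower X T d S h36 Sigma SigmaHat hsub hne hprime hp TpH HatH hle cuspMeetsH P.admKer_normal_pi).Q j).ι (c₂ e) * q)) ∧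
          (∃ (e : E) (k : ((qTowerOfSpecialFibreTower X T d S h36 Sigma SigmaHat hsub hne hprime hp TpH HatH hle cuspMeetsH P.admKer_normal_pi).Q j).Hat), ∃ p ∈ (((Dd j).vertGp (src e)).map ((qTowerOfSpecialFibreTower X T d S h36 Sigma SigmaHat hsub hne hprime hp TpH HatH hle cuspMeetsH P.admKer_normal_pi).Q j).ι).topologicalClosure,
              ∃ q ∈ (((Dd j).vertGp (tgt e)).map ((qTowerOfSpecialFibreTower X T d S h36 Sigma SigmaHat hsub hne hprime hp TpH HatH hle cuspMeetsH P.admKer_normal_pi).Q j).ι).topologicalClosure,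
              (src e = u ∧ tgt e = w ∧ f = k * ((qTowerOfSpecialFibreTower X T d S h36 Sigma SigmaHat hsub hne hprime hp TpH HatH hle cuspMeetsH P.admKer_normal_pi).Q j).ι (c₁ e) * p ∧ h = k * ((qTowerOfSpecialFibreTower X T d S h36 Sigma SigmaHat hsub hne hprime hp TpH HatH hle cuspMeetsH P.admKer_normal_pi).Q j).ι (c₂ e) * q) ∨
              (src e = w ∧ tgt e = u ∧ h = k * ((qTowerOfSpecialFibreTower X T d S h36 Sigma SigmaHat hsub hne hprime hp TpH HatH hle cuspMeetsH P.admKer_normal_pi).Q j).ι (c₁ e) * p ∧ f = k * ((qTowerOfSpecialFibreTower X T d S h36 Sigma SigmaHat hsub hne hprime hp TpH HatH hle cuspMeetsH P.admKer_normal_pi).Q j).ι (c₂ e) * q))) :=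
  fun j => hA3 j

/-! ### How the §2 one-call of record is now read (no restatement — the gate's `dedup.landed` confirms that ★ p506978's
`prop24_cor25_ofPiData_byName_noRF_frame_of_isFreeOrSurface_trichotomy` / `…_of_freePro_trichotomy` with `hVc_j`, `hA3tri_j` supplied by the
two bridges above IS, definitionally, the «by-name» one-call; a verbatim re-key would be a duplicate declaration):

  `prop24_cor25_ofPiData_byName_noRF_frame_of_isFreeOrSurface_trichotomy X d T … P Dd`
  `  (hVc_of_verticialEdgeLikeCompactAmpleStatement X d T … P Dd hVcS)   -- [SemiAnbd] Rmk 5.3.1 BY NAME`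
  `  β₁A β₂A srcA tgtA c₁A c₂A hβe hβne hsrcA htgtA hΓA hloopA hcovA        -- arithmetic endpoint DATA of Dd j`
  `  (hA3tri_of_arithCosetTreeTrichotomy X d T … P Dd hA3)                -- [NodNon] Prop 3.9 (i) BY NAME (p516099)`
  `  x hF e G hNN σ Λv hvert hΛv src tgt c₁ c₂ hends h₁ h₂ hloop hab hadm hI`

with `hVcS : ∀ j, VerticialEdgeLikeCompactAmpleStatement (Dd j) πA_j` and `hA3 : ∀ j, (Dd j).ArithCosetTreeTrichotomy ι_j (q̂_j ∘ toHat) augGK`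
(kernel-checked in the seat's scratch twin, farm rc 0).  BINDER CENSUS of that call: explicit LAW none; FACT BY NAME {F-2540 hNN,
Thm 5.4 (i) hI^frame, Rmk 5.3.1 hVcS, [NodNon] Prop 3.9 (i) hA3}; FACT-INSTANCE (x′)/(x); ORIGIN hab; GAP hadm. -/

end OneCall

end OfSpecialFibre

end StableCurveTemperedData

end Literature.IUT.HodgeTheaters

end
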